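import Mathlib
import Summits.ValiantsHypothesis.ValiantsHypothesis.Theorems.BinomialElusiveBinomialCandidateLowDegreeVanishing

/-!
# Crux `BinomialElusive.BinomialCandidate` (stmt-ValiantsHypothesis-7392), line `registered` —
# helper `lowDegreeVanishing_zero`: right-hand side `0` variant of `stub_lowDegreeVanishing`

Data as in `stub_lowDegreeVanishing`: exponents `a b : Fin m → ℕ`, `N > 0`, the binomials
`T_i := t^{N a_i} + t^{N b_i} ∈ ℂ((t))`, (P1) no nonzero integer relation
`Σ_i (u_i a_i + v_i b_i) = 0` of length `Σ_i (|u_i| + |v_i|) ≤ 4`, (P2) a modulus `M'` with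
`a_i ≡ b_i ≡ 1 (mod M')` and `2 e < M' e'` for all exponents `e, e'`.
Claim (`lowDegreeVanishing_zero`): if a polynomial `ψ` in all the variables `X_i`, without constant
term, satisfies `ψ(T) ≡ 0 (mod t^G)` with `G` beyond twice every `N a_i`, `N b_i`, then every
coefficient of `ψ` of degree `≤ 2` vanishes.  This is the uniqueness step of the cycle-2 cross-cap
argument for `stub_nonImmersiveIntegral` (a resultant `D(w)` in all target variables with
`D(T(t)) ≡ 0`).

Proof.  For `d ≠ 0` of degree `≤ 2` the special exponent `e⋆ := N Σ_i d_i a_i` is `< G`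
(`LowDegreeVanishing.special_lt`), and the coefficient of `ψ(T)` at `e⋆` is `coeff d ψ` by the
uniqueness of the low splitting under (P1)+(P2) (`LowDegreeVanishing.coeff_aeval_special`); the
hypothesis says this coefficient is `0`.  The degree-`0` coefficient is the constant term.
-/

-- layout Summits/ValiantsHypothesis/ValiantsHypothesis forces the duplicated namespace component
set_option linter.dupNamespace false

namespace Summit.ValiantsHypothesis.ValiantsHypothesis.Theorems.BinomialCandidateStubs

open scoped BigOperators
open Finset

open LowDegreeVanishing in
/-- **Helper `lowDegreeVanishing_zero`** (right-hand side `0` variant of `stub_lowDegreeVanishing`)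
of line `registered` (skeleton v2) of the crux `BinomialElusive.BinomialCandidate`: under (P1) (no
relation of length `≤ 4`) and (P2) (a congruence modulus `M'`), a polynomial `ψ` without constant
term with `ψ(T) ≡ 0 (mod t^G)` for `T_i = t^{N a_i} + t^{N b_i}` and `G > 2 N a_i, 2 N b_i` has all
coefficients of degree `≤ 2` equal to zero. -/
theorem lowDegreeVanishing_zero :
    ∀ (m : ℕ) (a b : Fin m → ℕ) (N : ℕ), 0 < N →
      (∀ u v : Fin m → ℤ, ∑ i, (|u i| + |v i|) ≤ 4 → ∑ i, (u i * (a i : ℤ) + v i * (b i : ℤ)) = 0 → (u, v) = 0) →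
      (∃ M' : ℕ, (∀ i, a i % M' = 1 ∧ b i % M' = 1) ∧
        (∀ i j, 2 * a i < M' * a j ∧ 2 * a i < M' * b j ∧ 2 * b i < M' * a j ∧ 2 * b i < M' * b j)) →
      ∀ (ψ : MvPolynomial (Fin m) ℂ) (G : ℤ), MvPolynomial.constantCoeff ψ = 0 →
        (∀ i, 2 * ((N * a i : ℕ) : ℤ) < G ∧ 2 * ((N * b i : ℕ) : ℤ) < G) →
        (∀ g < G, (MvPolynomial.aeval (fun i : Fin m => (HahnSeries.single ((N * a i : ℕ) : ℤ) (1 : ℂ) +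
            HahnSeries.single ((N * b i : ℕ) : ℤ) (1 : ℂ) : LaurentSeries ℂ)) ψ).coeff g = 0) →
        ∀ d : Fin m →₀ ℕ, (d.sum fun _ e => e) ≤ 2 → MvPolynomial.coeff d ψ = 0 := by
  intro m a b N hN hP1 hP2 ψ G hcc hG hcong d hd
  obtain ⟨M', hmod, hlt⟩ := hP2
  by_cases hd0 : d = 0
  · subst hd0
    rw [MvPolynomial.constantCoeff_eq] at hcc
    exact hcc
  have hdeg : ∑ i, d i ≤ 2 := by rwa [Finsupp.sum_fintype _ _ (fun _ => rfl)] at hd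
  -- an index in the support of `d` (only needed to make `Fin m` nonempty in `special_lt`)
  obtain ⟨i₀, -⟩ : ∃ i, d i ≠ 0 := by
    by_contra h
    push Not at h
    exact hd0 (Finsupp.ext h)
  have h1 := hcong _ (special_lt hG hdeg i₀)
  rwa [coeff_aeval_special a b N M' hN hP1 hmod hlt ψ d hdeg hd0] at h1

end Summit.ValiantsHypothesis.ValiantsHypothesis.Theorems.BinomialCandidateStubs
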